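/-
Copyright: statement-level skeleton of a published paper (lit-balaban cell, Phase-2 proof seat p25, gen 21). No proof
claims beyond what the kernel checks below.
-/
import Literature.MathematicalPhysics.QuantumFieldTheory.BalabanImbrieJaffe1984to88.BIJ88WalkProductCutoff312
import Literature.MathematicalPhysics.QuantumFieldTheory.BalabanImbrieJaffe1984to88.BIJ88WalkIneq312RemainderBdryN
import Literature.MathematicalPhysics.QuantumFieldTheory.BalabanImbrieJaffe1984to88.BIJ88VertexChiCubes312

/-!
# `BalabanImbrieJaffe1984to88.BIJ88WalkProductCutoffVolFree312` — T. Bałaban, J. Imbrie, A. Jaffe, *Effective action and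
cluster properties of the abelian Higgs model*, Commun. Math. Phys. **114** (1988) 257–315 [BalabanImbrieJaffe1988],
§5.2 p. 278 [PDF 22] (x2 render `lit-balaban-r16/renders/cmp114/original-p022-x2.png`), verbatim: the small-field
characteristic functions are PRODUCTS of one-variable factors, *"We insert a partition of unity under the integrals:
1 = Σ_{P_x⊂Λ₁₃^{(k−1)′}} Σ_{P_y⊂Λ₁₃^{(k−1)″}} Σ_{P_b⊂Λ₁₃^{(k−1)′*}} Σ_{P_p⊂Λ₁₃^{(k−1)′**}} × Π_{x∈P_x} χ^c_x
Π_{x∈Λ₁₃^{(k−1)′}∖P_x} χ_x … (5.2.1)"*, (5.2.2) *"χ_b = χ(p(e_k), |(D_{ū_k}φ)(b)|) = 1 − χ^c_b"*, (5.2.3)–(5.2.4)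
*"|dⁿ/dxⁿ χ(1, x)| ≦ cⁿn^{cn} for all n, x. … Then we put χ(p, x) = χ(1, x/p)"*; §5.14 p. 310 [PDF 54] *"The
others, localized in region X, have a factor of e^{−cr(e_k)|X|}."*, *"(We allow adjustments in β, α, β′, keeping them
small.)"* and p. 312 [PDF 56], the estimate preceding (5.14.5).

**THE PRODUCT-CUTOFF MEMBER MADE VOLUME-FREE** (p25 gen 21; file N4 of the member-level currency generalization of
row C2.Claim@312, owner r16 ruling 2026-08-23T11:27:10Z, condition (3)).  Gen 20's `BIJ88WalkProductCutoff312`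
measured the `χ′`-directions by the sup norm and paid the VOLUME FACTOR `(#B·a)^n` in the Leibniz bound
`‖D^n Π_{b∈B} χ₁(ℓ_bΦ)‖ ≤ (#B·a)^n` (its HONEST SCOPE (a)).  The exact multi-Leibniz/chain rule is sharper:
`|(Π_{i≤n}∂_{z_i}) Π_{b∈B} χ₁(ℓ_bΦ)| ≤ Π_i (a·N(z_i))` with the seminorm `N(z) := Σ_{b∈B}|ℓ_b(z)|` and NO `#B` (§1,
by induction on the directions through the class `Π_b χ₁^{(k_b)}(ℓ_bΦ)`), so in the currency `N` of gen 21's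
`BIJ88WalkIneq312RemainderBdryN.ineq312_remainder_bdry_N` the product-cutoff member has the constant
`K_V·a_O^{Φ₀(O)}·Λ_O^{mom}·W_O^{Φ₀(O)}` — VOLUME-FREE (§3–§4) —, the assumption `‖ℓ_b‖ ≤ 1` is no longer needed, and
the booking input becomes `hBzN : Σ_b|ℓ_b(C_p u)| ≤ B′_p ρ_p`: for site cutoffs `ℓ_b = Φ ↦ Φ(y_b)` an `ℓ¹→ℓ¹`
(column-sum) operator-norm letter on the pieces, `Σ_b|(C_p u)(y_b)| ≤ ‖C_p‖_{1→1}·R₁` on `Dir ⊆ {Σ|u| ≤ R₁}` (§5,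
displayed as the C1-type letter it is).

* §1 (calculus, [folklore]) `contDiff_prodIter`, `fderiv_prodIter_apply` (the derivative of `Π_b χ₁^{(k_b)}(ℓ_bΦ)`),
  **`abs_dlist_prodIter_le`** (THE ℓ¹-LEIBNIZ BOUND: `|(Π_{z∈D}∂_z)Π_b χ₁^{(k_b)}(ℓ_bΦ)| ≤ a^{Σk}·Π_{z∈D}(a·Σ_b|ℓ_b z|)`
  if `|χ₁^{(j)}| ≤ a^j` for `j ≤ Σk + |D|`), `abs_dlist_prodCutoff_le` (the scaled product cutoff: each direction
  costs `a·p⁻¹·Σ_b|ℓ_b z|`), `prodCutoff_sup_bound_N` (times `|e^{−V}| ≤ K_V`, at most `N` directions);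
* §3 **`prodCutoff_hE_N`** — the head's expectation clause in the currency `N(z) = Σ_b|ℓ_b z|`, DERIVED on the §5.13
  law, constant `K_V·a_O^{Φ₀(O)}·Λ_O^{mom}`, `a_O = max(1,c)·max(1,Φ₀(O))^c`, `η_χ = p⁻¹`;
* §4 **`ineq312_remainder_bdry_prodCutoff_N`** — `ineq312_remainder_bdry_N` with `N`, `χ`, `K_χ`, `η_χ`, `Λ` so
  instantiated: gen 20's `ineq312_remainder_bdry_prodCutoff` WITHOUT the `#B` factor and WITHOUT `‖ℓ_b‖ ≤ 1`;
* §5 `sum_abs_mulVec_le` (`Σ_x|(C u)_x| ≤ ‖C‖_{1→1}·Σ_y|u_y|`, `‖C‖_{1→1}` = max column sum, a letter `C₁`),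
  `sum_abs_site_le`, **`hBzN_site_of_colsum`** (the booking input of §4 for site cutoffs from the two letters
  `C₁(p)`, `R₁`).

statement-level skeleton of published theorems with citation tags; proofs where landed; nothing here is a claim
about the Yang–Mills mass gap

PDF held: `paper:balaban1988-cmp114-bij-abelian-higgs-effective-action` (journal page = PDF page + 256); p. 278 from
the x2 render as quoted; pp. 310, 312 as in the sibling files.

CITATION HEADER (lean-in-tree rule).  lit-balaban cell (HOME `run/shared/lean/pub/lit-balaban/`), Phase 2, seat p25
gen 21; row **C2.Claim@312** of `HOME/lit-balaban-r16/ROWS-C2-part2.md` (owner r16, referee ref-5; head theorem of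
record `BIJ88WalkIneq312RemainderBdry.ineq312_remainder_bdry` UNCHANGED; this file is a MEMBER — clause C3's cutoff
letter instantiated on print's product cutoffs in the volume-free currency).  USED BY NAME, nothing restated:
`BIJ88WalkIneq312RemainderBdryN.ineq312_remainder_bdry_N` (p25 gen 21), `BIJ88WalkProductCutoff312.derivBound_le_pow`,
`BIJ88WalkRemainderMoments312.remainder_moment_le`, `BIJ88WalkDirectionCount312.expand_dirs_length_le_phi0`,
`BIJ88WalkRemainderExpectation312.abs_integral_fieldLaw_le_sup`, `BIJ88WalkScaledCutoff309.dlist_const_mul`,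
`BIJ88VertexChiCubes312.dlist_sum`, `BIJ88IbpLeibniz312.dlist_contDiff` (p25 gen 17–20), r18's `CutoffProfile`.
HONEST SCOPE: (a) CLOSED relative to gen 20: no volume factor — the price of the cutoff is `a_O^{Φ₀(O)}` per located
family, uniformly in `#B`; (b) `K_V ≥ sup|e^{−V}|` and the legs' moment letters `μ_*, v_*` stay letters, as do the
pieces' sizes — now `Σ_b|ℓ_b(C_p u)| ≤ B′_p ρ_p`, for site cutoffs the column-sum letter `C₁(p)` of §5 (print's
random-walk decay of the pieces is not derived here); (c) the profile enters only through (5.2.3) and smoothness;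
(d) everything else as in the head ((H1)–(H5), clauses C1–C5 of the owner's record v2.311).  NOT summit progress; NOT
continuum; NOT Clay.  Imports `BIJ88WalkProductCutoff312`, `BIJ88WalkIneq312RemainderBdryN`, `BIJ88VertexChiCubes312`;
modifies nothing; 0 `sorry`, 0 definitions, 0 `Prop` facts.
-/

noncomputable section

namespace Literature.MathematicalPhysics.QuantumFieldTheory.BalabanImbrieJaffe1984to88.BIJ88WalkProductCutoffVolFree312

open Classical MeasureTheory Matrix Finset
open scoped BigOperators ContDiff
open Literature.MathematicalPhysics.QuantumFieldTheory.Balaban1983to89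
open B2Eq228Conditioning (weight source)
open BIJ88PolymerRep5134 (corner)
open BIJ88PolymerRep5134Gauss (prec src)
open BIJ88SlotMomentsGauss308 (fieldLaw)
open BIJ88VertexIbp311 (vexp continuous_vexp)
open BIJ88WickDerivatives305 (dlist dlist_nil dlist_cons)
open BIJ88IbpLeibniz312 (dlist_contDiff)
open BIJ88VertexChiCubes312 (dlist_sum)
open BIJ88WalkScaledCutoff309 (dlist_const_mul)
open BIJ88WalkRun311 BIJ88WalkExpansion311 BIJ88WalkRemainderActivity312 BIJ88WalkIneq312Remainder
  BIJ88WalkDirectionCount312 BIJ88WalkRemainderMoments312 BIJ88WalkRemainderExpectation312 BIJ88WalkProductCutoff312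
  BIJ88WalkIneq312RemainderBdryN

/-! ## §1  The ℓ¹-Leibniz bound: no volume factor -/

section Calculus
variable {S : Type} [Fintype S] {B : Type}

/-- the factors `Φ ↦ χ₁^{(k)}(ℓΦ)` are smooth. [folklore] [cite: BalabanImbrieJaffe1988, (5.2.2)-(5.2.3) p.278] -/
theorem contDiff_iteratedDeriv_comp {g : ℝ → ℝ} (hg : ContDiff ℝ ∞ g) (k : ℕ) (ℓ : (S → ℝ) →L[ℝ] ℝ) :
    ContDiff ℝ ∞ (fun Φ : S → ℝ => iteratedDeriv k g (ℓ Φ)) := by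
  have h : ContDiff ℝ ∞ (iteratedDeriv k g) := by rw [iteratedDeriv_eq_iterate]; exact hg.iterate_deriv k
  exact h.comp ℓ.contDiff

/-- the products `Φ ↦ Π_{b∈B} χ₁^{(k_b)}(ℓ_bΦ)` are smooth. [folklore] [cite: BalabanImbrieJaffe1988, (5.2.1)-(5.2.3) p.278] -/
theorem contDiff_prodIter {g : ℝ → ℝ} (hg : ContDiff ℝ ∞ g) (Bs : Finset B) (ℓ : B → (S → ℝ) →L[ℝ] ℝ) (k : B → ℕ) :
    ContDiff ℝ ∞ (fun Φ : S → ℝ => ∏ b ∈ Bs, iteratedDeriv (k b) g (ℓ b Φ)) :=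
  contDiff_prod fun b _ => contDiff_iteratedDeriv_comp hg (k b) (ℓ b)

/-- chain rule for one factor: `D[χ₁^{(k)}(ℓΦ)] = χ₁^{(k+1)}(ℓΦ)·ℓ`. [folklore] [cite: BalabanImbrieJaffe1988, (5.2.2) p.278] -/
theorem hasFDerivAt_iteratedDeriv_comp {g : ℝ → ℝ} (hg : ContDiff ℝ ∞ g) (k : ℕ) (ℓ : (S → ℝ) →L[ℝ] ℝ) (Φ : S → ℝ) :
    HasFDerivAt (fun Φ : S → ℝ => iteratedDeriv k g (ℓ Φ)) (iteratedDeriv (k + 1) g (ℓ Φ) • ℓ) Φ := by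
  have hd : Differentiable ℝ (iteratedDeriv k g) := by
    rw [iteratedDeriv_eq_iterate]; exact (hg.iterate_deriv k).differentiable (by simp)
  have h1 : HasDerivAt (iteratedDeriv k g) (iteratedDeriv (k + 1) g (ℓ Φ)) (ℓ Φ) := by
    rw [iteratedDeriv_succ]; exact (hd _).hasDerivAt
  exact h1.comp_hasFDerivAt Φ ℓ.hasFDerivAt

/-- **Leibniz over the factors, chain rule in each**: `∂_z Π_{b∈B} χ₁^{(k_b)}(ℓ_bΦ) =
Σ_{b₀∈B} ℓ_{b₀}(z)·χ₁^{(k_{b₀}+1)}(ℓ_{b₀}Φ)·Π_{b≠b₀} χ₁^{(k_b)}(ℓ_bΦ)`. [folklore] [cite: BalabanImbrieJaffe1988, (5.2.1)-(5.2.2) p.278] -/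
theorem fderiv_prodIter_apply {g : ℝ → ℝ} (hg : ContDiff ℝ ∞ g) (Bs : Finset B) (ℓ : B → (S → ℝ) →L[ℝ] ℝ) (k : B → ℕ)
    (Φ z : S → ℝ) :
    fderiv ℝ (fun Φ : S → ℝ => ∏ b ∈ Bs, iteratedDeriv (k b) g (ℓ b Φ)) Φ z
      = ∑ b₀ ∈ Bs, ℓ b₀ z * (iteratedDeriv (k b₀ + 1) g (ℓ b₀ Φ) * ∏ b ∈ Bs.erase b₀, iteratedDeriv (k b) g (ℓ b Φ)) := by
  have h := HasFDerivAt.finsetProd (u := Bs) (fun b _ => hasFDerivAt_iteratedDeriv_comp hg (k b) (ℓ b) Φ)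
  rw [h.fderiv]
  simp only [FunLike.coe_sum, Finset.sum_apply, FunLike.coe_smul, Pi.smul_apply, smul_eq_mul]
  exact Finset.sum_congr rfl fun b₀ _ => by ring

omit [Fintype S] in
/-- bookkeeping: the product with one exponent raised. [folklore] -/
private theorem prodIter_update (Bs : Finset B) (ℓ : B → (S → ℝ) →L[ℝ] ℝ) (g : ℝ → ℝ) (k : B → ℕ) {b₀ : B} (hb₀ : b₀ ∈ Bs)
    (Φ : S → ℝ) :
    ∏ b ∈ Bs, iteratedDeriv (Function.update k b₀ (k b₀ + 1) b) g (ℓ b Φ)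
      = iteratedDeriv (k b₀ + 1) g (ℓ b₀ Φ) * ∏ b ∈ Bs.erase b₀, iteratedDeriv (k b) g (ℓ b Φ) := by
  rw [← Finset.mul_prod_erase Bs _ hb₀, Function.update_self]
  congr 1
  exact Finset.prod_congr rfl fun b hb => by rw [Function.update_of_ne (Finset.ne_of_mem_erase hb)]

/-- bookkeeping: raising one exponent raises the total order by one. [folklore] -/
private theorem sum_update_succ (Bs : Finset B) (k : B → ℕ) {b₀ : B} (hb₀ : b₀ ∈ Bs) :
    ∑ b ∈ Bs, Function.update k b₀ (k b₀ + 1) b = ∑ b ∈ Bs, k b + 1 := by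
  rw [Finset.sum_update_of_mem hb₀, Finset.sdiff_singleton_eq_erase, ← Finset.add_sum_erase Bs k hb₀]
  ring

/-- **THE ℓ¹-LEIBNIZ BOUND (NO VOLUME FACTOR)**: if `|χ₁^{(j)}| ≤ a^j` for all `j ≤ N_tot` (`a ≥ 0`), then for every
list of directions `D` and exponents `k` with `Σ_b k_b + |D| ≤ N_tot`,
`|(Π_{z∈D}∂_z) Π_{b∈B} χ₁^{(k_b)}(ℓ_bΦ)| ≤ a^{Σ_b k_b}·Π_{z∈D}(a·Σ_{b∈B}|ℓ_b(z)|)` — each direction is charged the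
SEMINORM `Σ_b|ℓ_b z|`, not `#B·‖z‖`. [folklore] [cite: BalabanImbrieJaffe1988, (5.2.1)-(5.2.3) p.278] -/
theorem abs_dlist_prodIter_le {g : ℝ → ℝ} (hg : ContDiff ℝ ∞ g) {a : ℝ} (ha : 0 ≤ a) {Ntot : ℕ}
    (hga : ∀ j ≤ Ntot, ∀ t, |iteratedDeriv j g t| ≤ a ^ j) (Bs : Finset B) (ℓ : B → (S → ℝ) →L[ℝ] ℝ) :
    ∀ (D : List (S → ℝ)) (k : B → ℕ), (∑ b ∈ Bs, k b) + D.length ≤ Ntot → ∀ φ : S → ℝ,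
      |dlist D (fun Φ : S → ℝ => ∏ b ∈ Bs, iteratedDeriv (k b) g (ℓ b Φ)) φ|
        ≤ a ^ (∑ b ∈ Bs, k b) * (D.map fun z => a * ∑ b ∈ Bs, |ℓ b z|).prod
  | [], k, hk, φ => by
    rw [dlist_nil, List.map_nil, List.prod_nil, mul_one, Finset.abs_prod, ← Finset.prod_pow_eq_pow_sum]
    refine Finset.prod_le_prod (fun b _ => abs_nonneg _) fun b hb => hga (k b) ?_ _
    simp only [List.length_nil, add_zero] at hk
    exact (Finset.single_le_sum (fun b _ => Nat.zero_le (k b)) hb).trans hk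
  | z :: D, k, hk, φ => by
    rw [dlist_cons]
    have e1 : (fun Φ : S → ℝ => fderiv ℝ (fun Φ : S → ℝ => ∏ b ∈ Bs, iteratedDeriv (k b) g (ℓ b Φ)) Φ z)
        = fun Φ => ∑ b₀ ∈ Bs,
            ℓ b₀ z * ∏ b ∈ Bs, iteratedDeriv (Function.update k b₀ (k b₀ + 1) b) g (ℓ b Φ) := by
      funext Φ
      rw [fderiv_prodIter_apply hg Bs ℓ k Φ z]
      exact Finset.sum_congr rfl fun b₀ hb₀ => by rw [prodIter_update Bs ℓ g k hb₀]
    rw [e1, dlist_sum D Bs (fun b₀ _ => contDiff_const.mul (contDiff_prodIter hg Bs ℓ _))]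
    have e2 : ∀ b₀ ∈ Bs,
        dlist D (fun Φ => ℓ b₀ z * ∏ b ∈ Bs, iteratedDeriv (Function.update k b₀ (k b₀ + 1) b) g (ℓ b Φ)) φ
          = ℓ b₀ z * dlist D (fun Φ => ∏ b ∈ Bs, iteratedDeriv (Function.update k b₀ (k b₀ + 1) b) g (ℓ b Φ)) φ :=
      fun b₀ _ => by rw [dlist_const_mul D (contDiff_prodIter hg Bs ℓ _) (ℓ b₀ z)]
    have hlen : (∑ b ∈ Bs, k b) + 1 + D.length ≤ Ntot := by
      simp only [List.length_cons] at hk; omega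
    calc |∑ b₀ ∈ Bs, dlist D (fun Φ => ℓ b₀ z
              * ∏ b ∈ Bs, iteratedDeriv (Function.update k b₀ (k b₀ + 1) b) g (ℓ b Φ)) φ|
        ≤ ∑ b₀ ∈ Bs, |dlist D (fun Φ => ℓ b₀ z
              * ∏ b ∈ Bs, iteratedDeriv (Function.update k b₀ (k b₀ + 1) b) g (ℓ b Φ)) φ| :=
          Finset.abs_sum_le_sum_abs _ _
      _ ≤ ∑ b₀ ∈ Bs, |ℓ b₀ z| * (a ^ (∑ b ∈ Bs, k b + 1) * (D.map fun z => a * ∑ b ∈ Bs, |ℓ b z|).prod) := by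
          refine Finset.sum_le_sum fun b₀ hb₀ => ?_
          rw [e2 b₀ hb₀, abs_mul]
          refine mul_le_mul_of_nonneg_left ?_ (abs_nonneg _)
          have IH := abs_dlist_prodIter_le hg ha hga Bs ℓ D (Function.update k b₀ (k b₀ + 1))
            (by rw [sum_update_succ Bs k hb₀]; exact hlen) φ
          rwa [sum_update_succ Bs k hb₀] at IH
      _ = a ^ (∑ b ∈ Bs, k b) * ((a * ∑ b₀ ∈ Bs, |ℓ b₀ z|) * (D.map fun z => a * ∑ b ∈ Bs, |ℓ b z|).prod) := by
          rw [← Finset.sum_mul, pow_succ]; ring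
      _ = _ := by rw [List.map_cons, List.prod_cons]

/-- **THE SCALED PRODUCT CUTOFF `χ(ψ) = Π_{b∈B} χ₁(ℓ_b(ψ)/p)`**: for `p > 0` and at most `N_tot` directions,
`|(Π_{z∈D}∂_z)χ(φ)| ≤ Π_{z∈D}(a·p⁻¹·Σ_b|ℓ_b z|)` — each field derivative costs `1/p` (print p. 309) times the
seminorm, no `#B`. [cite: BalabanImbrieJaffe1988, (5.2.4) p.278; §5.14 p.309] -/
theorem abs_dlist_prodCutoff_le {g : ℝ → ℝ} (hg : ContDiff ℝ ∞ g) {a : ℝ} (ha : 0 ≤ a) {Ntot : ℕ}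
    (hga : ∀ j ≤ Ntot, ∀ t, |iteratedDeriv j g t| ≤ a ^ j) (Bs : Finset B) (ℓ : B → (S → ℝ) →L[ℝ] ℝ)
    {p : ℝ} (hp : 0 < p) :
    ∀ D : List (S → ℝ), D.length ≤ Ntot → ∀ φ : S → ℝ,
      |dlist D (fun ψ : S → ℝ => ∏ b ∈ Bs, g (p⁻¹ * ℓ b ψ)) φ|
        ≤ (D.map fun z => a * (p⁻¹ * ∑ b ∈ Bs, |ℓ b z|)).prod := by
  intro D hD φ
  have e : (fun ψ : S → ℝ => ∏ b ∈ Bs, g (p⁻¹ * ℓ b ψ))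
      = fun Φ => ∏ b ∈ Bs, iteratedDeriv ((fun _ : B => (0 : ℕ)) b) g ((p⁻¹ • ℓ b) Φ) := by
    funext ψ
    exact Finset.prod_congr rfl fun b _ => by
      rw [iteratedDeriv_zero, FunLike.coe_smul, Pi.smul_apply, smul_eq_mul]
  have h := abs_dlist_prodIter_le hg ha hga Bs (fun b => p⁻¹ • ℓ b) D (fun _ : B => (0 : ℕ))
    (by simp only [Finset.sum_const_zero, zero_add]; exact hD) φ
  have e2 : (fun z : S → ℝ => a * ∑ b ∈ Bs, |(p⁻¹ • ℓ b) z|) = fun z => a * (p⁻¹ * ∑ b ∈ Bs, |ℓ b z|) := by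
    funext z
    congr 1
    rw [Finset.mul_sum]
    exact Finset.sum_congr rfl fun b _ => by
      rw [FunLike.coe_smul, Pi.smul_apply, smul_eq_mul, abs_mul, abs_of_pos (inv_pos.2 hp)]
  simp only [Finset.sum_const_zero, pow_zero, one_mul, e2] at h
  rw [e]
  exact h

/-- **EACH DIRECTION COSTS `(max 1 a)·p⁻¹·Σ_b|ℓ_b z|`, TIMES `|e^{−V}| ≤ K_V`**: for at most `N_tot` directions,
`|(Π_{z∈D}∂_z)χ(φ)·e^{−V(φ)}| ≤ K_V·(max 1 a)^{N_tot}·Π_{z∈D}(p⁻¹·Σ_b|ℓ_b z|)`. [cite: BalabanImbrieJaffe1988, §5.14 p.309; (5.2.3)-(5.2.4) p.278] -/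
theorem prodCutoff_sup_bound_N {ι : Type} [Fintype ι] {g : ℝ → ℝ} (hg : ContDiff ℝ ∞ g) {a : ℝ} (ha : 0 ≤ a) {Ntot : ℕ}
    (hga : ∀ j ≤ Ntot, ∀ t, |iteratedDeriv j g t| ≤ a ^ j) (Bs : Finset B) (ℓ : B → (S → ℝ) →L[ℝ] ℝ)
    {p : ℝ} (hp : 0 < p) (c : ι → ℝ) (legs : ι → List (S → ℝ)) {KV : ℝ} (hV : ∀ φ, |vexp c legs φ| ≤ KV) :
    ∀ D : List (S → ℝ), D.length ≤ Ntot → ∀ φ : S → ℝ,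
      |dlist D (fun ψ : S → ℝ => ∏ b ∈ Bs, g (p⁻¹ * ℓ b ψ)) φ * vexp c legs φ|
        ≤ KV * (max 1 a) ^ Ntot * (D.map fun z => p⁻¹ * ∑ b ∈ Bs, |ℓ b z|).prod := by
  intro D hD φ
  have hKV : 0 ≤ KV := (abs_nonneg _).trans (hV φ)
  have h0 : 0 ≤ (D.map fun z : S → ℝ => p⁻¹ * ∑ b ∈ Bs, |ℓ b z|).prod :=
    List.prod_nonneg fun x hx => by
      obtain ⟨z, -, rfl⟩ := List.mem_map.1 hx
      exact mul_nonneg (inv_nonneg.2 hp.le) (Finset.sum_nonneg fun b _ => abs_nonneg _)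
  have hprod : (D.map fun z => a * (p⁻¹ * ∑ b ∈ Bs, |ℓ b z|)).prod
      = a ^ D.length * (D.map fun z => p⁻¹ * ∑ b ∈ Bs, |ℓ b z|).prod := by
    rw [List.prod_map_mul, List.map_const', List.prod_replicate]
  have ha' : a ^ D.length ≤ (max 1 a) ^ Ntot :=
    (pow_le_pow_left₀ ha (le_max_right 1 a) _).trans (pow_le_pow_right₀ (le_max_left 1 a) hD)
  rw [abs_mul]
  calc |dlist D (fun ψ : S → ℝ => ∏ b ∈ Bs, g (p⁻¹ * ℓ b ψ)) φ| * |vexp c legs φ|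
      ≤ (a ^ D.length * (D.map fun z => p⁻¹ * ∑ b ∈ Bs, |ℓ b z|).prod) * KV :=
        mul_le_mul ((abs_dlist_prodCutoff_le hg ha hga Bs ℓ hp D hD φ).trans_eq hprod) (hV φ) (abs_nonneg _)
          (mul_nonneg (pow_nonneg ha _) h0)
    _ ≤ ((max 1 a) ^ Ntot * (D.map fun z => p⁻¹ * ∑ b ∈ Bs, |ℓ b z|).prod) * KV :=
        mul_le_mul_of_nonneg_right (mul_le_mul_of_nonneg_right ha' h0) hKV
    _ = _ := by ring

end Calculus

/-! ## §3  The expectation clause `hE_N` for product cutoffs, derived — volume-free -/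

section Law

variable {ι : Type} [Fintype ι] {κ : Type} [LinearOrder κ] {P : Type} [Fintype P] {β : Type} [DecidableEq β]
variable {α I : Type} [Fintype α] [DecidableEq α] [Fintype I] [DecidableEq I]
  {blk : α → I} {Δ : Matrix α α ℝ} {ℱ : α → ℝ} {W : Finset I}

/-- **THE HEAD'S EXPECTATION CLAUSE FOR PRINT'S PRODUCT CUTOFFS IN THE CURRENCY `N(z) = Σ_b|ℓ_b z|`, DERIVED** on
the §5.13 law: for `χ(ψ) = Π_{b∈B} χ₁(ℓ_b(ψ)/p)` (`χ₁` with (5.2.3)), every no-block term `t` of `expand 0 O` satisfies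
`|𝔼_W[Π_{pending}(Φ·w)·(Π_{z∈dirs t}∂_z)χ·e^{−V}]| ≤ K_V·Π_{z}(p⁻¹·Σ_b|ℓ_b z|)·(a_O^{Φ₀(O)}·Λ_O^{mom})`,
`a_O = max(1, max(1,c)·max(1,Φ₀(O))^c)` — NO `#B`: the term has at most `Φ₀(O)` directions
(`expand_dirs_length_le_phi0`), (5.2.3) holds to that order (`derivBound_le_pow`), and the moments are gen 20's
`remainder_moment_le`. [cite: BalabanImbrieJaffe1988, §5.14 p.312; p.309; (5.2.3)-(5.2.4) p.278] -/
theorem prodCutoff_hE_N (hPD : (prec blk Δ W (corner ℝ W)).PosDef)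
    {Cov : P → Matrix {x : α // blk x ∈ W} {x : α // blk x ∈ W} ℝ} {trig : P → Bool} {c : ι → ℝ}
    {legs : ι → List ({x : α // blk x ∈ W} → ℝ)} {obs : κ → List ({x : α // blk x ∈ W} → ℝ)} {M : ℕ}
    {B : Type} (Bs : Finset B) (ℓ : B → ({x : α // blk x ∈ W} → ℝ) →L[ℝ] ℝ)
    {g : ℝ → ℝ} (hg : ContDiff ℝ ∞ g) {cg : ℝ}
    (hgc : ∀ (n : ℕ) (x : ℝ), |iteratedDeriv n g x| ≤ cg ^ n * (n : ℝ) ^ (cg * n))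
    {KV p μs vs : ℝ} (hV : ∀ φ, |vexp c legs φ| ≤ KV) (hp : 0 < p) (hμs : 0 ≤ μs) (hvs : 0 ≤ vs)
    (hobs : ∀ j, ∀ w ∈ obs j, |w ⬝ᵥ ((prec blk Δ W (corner ℝ W))⁻¹ *ᵥ src blk ℱ W)| ≤ μs ∧
      w ⬝ᵥ ((prec blk Δ W (corner ℝ W))⁻¹ *ᵥ w) ≤ vs)
    (hlegs : ∀ m, ∀ w ∈ legs m, |w ⬝ᵥ ((prec blk Δ W (corner ℝ W))⁻¹ *ᵥ src blk ℱ W)| ≤ μs ∧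
      w ⬝ᵥ ((prec blk Δ W (corner ℝ W))⁻¹ *ᵥ w) ≤ vs) :
    ∀ O : Finset κ, ∀ t ∈ expand Cov trig (src blk ℱ W) c legs obs M 0 O, t.consts = 0 →
      |∫ φ, ((t.groups.map fun h => (h.pend : Multiset _)).sum.map fun w => φ ⬝ᵥ w).prod
          * (dlist t.dirs (fun ψ => ∏ b ∈ Bs, g (p⁻¹ * ℓ b ψ)) φ * vexp c legs φ) ∂(fieldLaw blk Δ ℱ W)|
        ≤ KV * (t.dirs.map fun z => p⁻¹ * ∑ b ∈ Bs, |ℓ b z|).prod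
          * ((max 1 (max 1 cg * (max 1 (phi0 legs obs M O : ℝ)) ^ cg)) ^ phi0 legs obs M O
            * ∑ N ∈ range (phi0 legs obs M O + 1), 2 ^ N * (μs ^ N + (1 + vs ^ N * ((2 * N - 1).doubleFactorial : ℝ)))) := by
  intro O t ht h0
  set a := max 1 cg * (max 1 (phi0 legs obs M O : ℝ)) ^ cg with ha_def
  have ha0 : 0 ≤ a :=
    mul_nonneg (zero_le_one.trans (le_max_left _ _)) (Real.rpow_nonneg (zero_le_one.trans (le_max_left _ _)) _)
  have hga : ∀ j ≤ phi0 legs obs M O, ∀ x, |iteratedDeriv j g x| ≤ a ^ j := fun j hj x => by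
    rw [← Real.norm_eq_abs]; exact derivBound_le_pow hgc _ j hj x
  have hKV : 0 ≤ KV := (abs_nonneg _).trans (hV 0)
  -- the sup bound for this term's directions (at most `Φ₀(O)` of them)
  have hsup := prodCutoff_sup_bound_N hg ha0 hga Bs ℓ hp c legs hV t.dirs
    (expand_dirs_length_le_phi0 (Cov := Cov) (trig := trig) (c := c) O t ht)
  have hχc : Continuous (dlist t.dirs fun ψ : {x : α // blk x ∈ W} → ℝ => ∏ b ∈ Bs, g (p⁻¹ * ℓ b ψ)) := by
    refine (dlist_contDiff t.dirs (contDiff_prod fun b _ => hg.comp ?_)).continuous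
    exact contDiff_const.mul (ℓ b).contDiff
  have h1 := abs_integral_fieldLaw_le_sup (ℱ := ℱ) hPD (hχc.mul (continuous_vexp c legs)) hsup
    ((t.groups.map fun h => (h.pend : Multiset _)).sum)
  have hD0 : 0 ≤ (t.dirs.map fun z : {x : α // blk x ∈ W} → ℝ => p⁻¹ * ∑ b ∈ Bs, |ℓ b z|).prod :=
    List.prod_nonneg fun x hx => by
      obtain ⟨z, -, rfl⟩ := List.mem_map.1 hx
      exact mul_nonneg (inv_nonneg.2 hp.le) (Finset.sum_nonneg fun b _ => abs_nonneg _)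
  have hK0 : 0 ≤ KV * (max 1 a) ^ phi0 legs obs M O * (t.dirs.map fun z => p⁻¹ * ∑ b ∈ Bs, |ℓ b z|).prod :=
    mul_nonneg (mul_nonneg hKV (pow_nonneg (zero_le_one.trans (le_max_left _ _)) _)) hD0
  refine (h1.trans (mul_le_mul_of_nonneg_left (remainder_moment_le blk Δ ℱ W hPD hμs hvs hobs hlegs O t ht h0)
    hK0)).trans (le_of_eq ?_)
  ring

/-! ## §4  The head theorem in the currency `N`, instantiated on product cutoffs: volume-free -/

/-- **THE HEAD THEOREM OF ROW C2.Claim@312 FOR PRINT'S PRODUCT CUTOFFS, VOLUME-FREE**: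
`BIJ88WalkIneq312RemainderBdryN.ineq312_remainder_bdry_N` with `N z := Σ_{b∈B}|ℓ_b z|`, `χ := Π_{b∈B} χ₁(ℓ_b/p)`
((5.2.1)–(5.2.4): profile `χ₁` with (5.2.3), ANY linear functionals `ℓ_b`, scale `p ≥ 1`), `K_χ := K_V`,
`η_χ := p⁻¹`, `Λ_O := a_O^{Φ₀(O)}·Σ_{N≤Φ₀(O)}2^N(μ_*^N + 1 + v_*^N(2N−1)‼)`; the clause `hE_N` is DISCHARGED (§3); the
booking clause reads `hBzN : Σ_b|ℓ_b(C_p u)| ≤ B′_p ρ_p` (an `ℓ¹`-type size of the pieces, §5); all other clauses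
verbatim the head's; CONCLUSION the head's with `c_F = K_V·Λ_O·W_O^{Φ₀(O)}` FREE OF `#B` (gen 20's
`ineq312_remainder_bdry_prodCutoff` had `(#B·a_O)^{Φ₀(O)}`).
[cite: BalabanImbrieJaffe1988, §5.14 p.312 (estimate preceding (5.14.5)); p.310; (5.2.1)-(5.2.4) p.278] -/
theorem ineq312_remainder_bdry_prodCutoff_N (hPD : (prec blk Δ W (corner ℝ W)).PosDef)
    {Cov : P → Matrix {x : α // blk x ∈ W} {x : α // blk x ∈ W} ℝ} {trig : P → Bool} {c : ι → ℝ}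
    {legs : ι → List ({x : α // blk x ∈ W} → ℝ)} {obs : κ → List ({x : α // blk x ∈ W} → ℝ)} {M : ℕ}
    {oc : κ → Finset β} {vc : ι → Finset β} {reg : P → Finset β}
    {Dir : Set ({x : α // blk x ∈ W} → ℝ)} {B' ρ : P → ℝ} {cV : ι → ℝ} {Bl θ θv θw ρ₀ : ℝ} {N₀ : ℕ}
    {B : Type} (Bs : Finset B) (ℓ : B → ({x : α // blk x ∈ W} → ℝ) →L[ℝ] ℝ)
    {g : ℝ → ℝ} (hg : ContDiff ℝ ∞ g) {cg : ℝ}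
    (hgc : ∀ (n : ℕ) (x : ℝ), |iteratedDeriv n g x| ≤ cg ^ n * (n : ℝ) ^ (cg * n))
    {KV p μs vs : ℝ} (hV : ∀ φ, |vexp c legs φ| ≤ KV) (hp1 : 1 ≤ p) (hμs : 0 ≤ μs) (hvs : 0 ≤ vs)
    (hobsm : ∀ j, ∀ w ∈ obs j, |w ⬝ᵥ ((prec blk Δ W (corner ℝ W))⁻¹ *ᵥ src blk ℱ W)| ≤ μs ∧
      w ⬝ᵥ ((prec blk Δ W (corner ℝ W))⁻¹ *ᵥ w) ≤ vs)
    (hlegsm : ∀ m, ∀ w ∈ legs m, |w ⬝ᵥ ((prec blk Δ W (corner ℝ W))⁻¹ *ᵥ src blk ℱ W)| ≤ μs ∧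
      w ⬝ᵥ ((prec blk Δ W (corner ℝ W))⁻¹ *ᵥ w) ≤ vs)
    (hθ0 : 0 < θ) (hθ1 : θ ≤ 1) (hBl : 1 ≤ Bl) (hB0 : ∀ p, 0 ≤ B' p) (hρ : ∀ p, 0 ≤ ρ p) (hcV0 : ∀ m, 0 ≤ cV m)
    (hθv : 0 < θv) (hθv1 : θv ≤ 1) (hθw : 0 < θw) (hθw1 : θw ≤ 1)
    (hB : ∀ p, ∀ u ∈ Dir, ∀ w ∈ Dir, |(Cov p *ᵥ u) ⬝ᵥ w| ≤ B' p * ρ p)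
    (hBf : ∀ p, ∀ u ∈ Dir, |(Cov p *ᵥ u) ⬝ᵥ src blk ℱ W| ≤ B' p * ρ p)
    (hBzN : ∀ p, ∀ u ∈ Dir, (∑ b ∈ Bs, |ℓ b (Cov p *ᵥ u)|) ≤ B' p * ρ p)
    (hcV : ∀ m, |c m| ≤ cV m) (hobs : ∀ j, ∀ w ∈ obs j, w ∈ Dir) (hlegs : ∀ m, ∀ w ∈ legs m, w ∈ Dir)
    (hloc : ∀ p, trig p = false → B' p ≤ Bl ∧ reg p = ∅) (hwalk : ∀ p, trig p = true → B' p ≤ θw * θ ^ (reg p).card)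
    (hvert : ∀ m, cV m * Bl ^ (legs m).length ≤ θv * θ ^ (vc m).card) (hρ₀0 : 0 ≤ ρ₀)
    (hρ₀ : ∀ u ∈ Dir, (∑ p ∈ univ.filter (fun p => Cov p *ᵥ u ≠ 0), ρ p) ≤ ρ₀)
    (hN₀ : ∀ p, ∀ u ∈ Dir,
      (∑ m, ((range (legs m).length).filter fun j => (Cov p *ᵥ u) ⬝ᵥ (legs m).getD j 0 ≠ 0).card) ≤ N₀)
    (bdry : Finset κ)
    (hbeat : ∀ O : Finset κ, ∀ t ∈ expand Cov trig (src blk ℱ W) c legs obs M 0 O, t.consts = 0 → ∀ X ∈ t.groups,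
      max p⁻¹ (max (θv ^ M) θw) * ∏ j ∈ X.lab.filter (fun j => j ∉ bdry), Bl ^ (obs j).length ≤ 1) :
    BIJ88Sect5StatementsPart4.Ineq312 (remSys κ β)
      (fun OX => remAt (prec blk Δ W (corner ℝ W)) Cov trig (src blk ℱ W) c legs obs M
        (fun ψ => ∏ b ∈ Bs, g (p⁻¹ * ℓ b ψ)) oc vc reg [] 0 OX.1 OX.2
        / ∫ φ, weight (prec blk Δ W (corner ℝ W)) φ * source (src blk ℱ W) φ)
      (fun OX => KV * ((max 1 (max 1 cg * (max 1 (phi0 legs obs M OX.1 : ℝ)) ^ cg)) ^ phi0 legs obs M OX.1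
            * ∑ N ∈ range (phi0 legs obs M OX.1 + 1), 2 ^ N * (μs ^ N + (1 + vs ^ N * ((2 * N - 1).doubleFactorial : ℝ))))
          * (max 1 (ρ₀ * ((phi0 legs obs M OX.1 + N₀ : ℕ) : ℝ))) ^ phi0 legs obs M OX.1)
      (fun OX => ∏ j ∈ OX.1.filter (fun j => j ∈ bdry), Bl ^ (obs j).length)
      (fun OX => nfreeOf oc OX.2) θ 1 := by
  have hp : 0 < p := zero_lt_one.trans_le hp1
  have hKV : 0 ≤ KV := (abs_nonneg _).trans (hV fun _ => 0)
  have hΛ : ∀ O : Finset κ, 0 ≤ (max 1 (max 1 cg * (max 1 (phi0 legs obs M O : ℝ)) ^ cg)) ^ phi0 legs obs M O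
      * ∑ N ∈ range (phi0 legs obs M O + 1), 2 ^ N * (μs ^ N + (1 + vs ^ N * ((2 * N - 1).doubleFactorial : ℝ))) :=
    fun O => mul_nonneg (pow_nonneg (zero_le_one.trans (le_max_left _ _)) _) (Finset.sum_nonneg fun N _ => by positivity)
  exact ineq312_remainder_bdry_N (N := fun z => ∑ b ∈ Bs, |ℓ b z|) (oc := oc) (vc := vc) (reg := reg) hPD
    (fun z => Finset.sum_nonneg fun b _ => abs_nonneg _) (by simp) hθ0 hθ1 hBl hB0 hρ hcV0 (inv_pos.mpr hp).le
    (inv_le_one_of_one_le₀ hp1) hθv hθv1 hθw hθw1 hB hBf hBzN hcV hobs hlegs hloc hwalk hvert hρ₀0 hρ₀ hN₀ hKV hΛ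
    (fun O t ht h0 => (prodCutoff_hE_N hPD Bs ℓ hg hgc hV hp hμs hvs hobsm hlegsm O t ht h0).trans (le_of_eq (by ring)))
    bdry hbeat

end Law

/-! ## §5  The booking letter of the volume-free currency: an `ℓ¹→ℓ¹` operator norm on the pieces -/

section L1Letters

variable {S : Type} [Fintype S]

/-- **`ℓ¹→ℓ¹` operator norm = maximal column sum**: if `Σ_x|C_{xy}| ≤ C₁` for every column `y`, then
`Σ_x|(C u)_x| ≤ C₁·Σ_y|u_y|`. [folklore] [cite: BalabanImbrieJaffe1988, §5.14 p.310] -/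
theorem sum_abs_mulVec_le (A : Matrix S S ℝ) {C₁ : ℝ} (hC : ∀ y, ∑ x, |A x y| ≤ C₁) (u : S → ℝ) :
    ∑ x, |(A *ᵥ u) x| ≤ C₁ * ∑ y, |u y| := by
  calc ∑ x, |(A *ᵥ u) x| = ∑ x, |∑ y, A x y * u y| := rfl
    _ ≤ ∑ x, ∑ y, |A x y| * |u y| := Finset.sum_le_sum fun x _ =>
        (Finset.abs_sum_le_sum_abs _ _).trans (le_of_eq (Finset.sum_congr rfl fun y _ => abs_mul _ _))
    _ = ∑ y, |u y| * ∑ x, |A x y| := by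
        rw [Finset.sum_comm]
        exact Finset.sum_congr rfl fun y _ => by rw [Finset.mul_sum]; exact Finset.sum_congr rfl fun x _ => mul_comm _ _
    _ ≤ ∑ y, |u y| * C₁ := Finset.sum_le_sum fun y _ => mul_le_mul_of_nonneg_left (hC y) (abs_nonneg _)
    _ = C₁ * ∑ y, |u y| := by rw [← Finset.sum_mul, mul_comm]

/-- site functionals at distinct sites see at most the `ℓ¹` norm: `Σ_{b∈B}|z(y_b)| ≤ Σ_x|z_x|` for `y` injective on
`B`. [folklore] [cite: BalabanImbrieJaffe1988, (5.2.2) p.278] -/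
theorem sum_abs_site_le {B : Type} (Bs : Finset B) {y : B → S} (hy : Set.InjOn y Bs) (z : S → ℝ) :
    ∑ b ∈ Bs, |z (y b)| ≤ ∑ x, |z x| := by
  rw [← Finset.sum_image (f := fun x => |z x|) hy]
  exact Finset.sum_le_sum_of_subset_of_nonneg (Finset.subset_univ _) fun _ _ _ => abs_nonneg _

/-- **THE BOOKING INPUT `hBzN` OF §4 FOR SITE CUTOFFS, FROM TWO VOLUME-FREE LETTERS**: for `χ = Π_{b∈B} χ₁(Φ(y_b)/p)`
(distinct sites `y_b`, (5.2.2)), pieces with column sums `Σ_x|(C_p)_{xy}| ≤ C₁(p)` and directions with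
`Σ_x|u_x| ≤ R₁` on `Dir`: `Σ_b|(C_p u)(y_b)| ≤ C₁(p)·R₁` — the `N`-size of the pieces is an `ℓ¹→ℓ¹` operator-norm
letter, independent of `#B` (next to the head's `ℓ^∞` bracket letters C1). [cite: BalabanImbrieJaffe1988, §5.14 p.310; (5.2.2) p.278] -/
theorem hBzN_site_of_colsum {P B : Type} (Bs : Finset B) {y : B → S} (hy : Set.InjOn y Bs)
    {Cov : P → Matrix S S ℝ} {C₁ : P → ℝ} (hC0 : ∀ p, 0 ≤ C₁ p) (hC : ∀ p yy, ∑ x, |Cov p x yy| ≤ C₁ p)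
    {Dir : Set (S → ℝ)} {R₁ : ℝ} (hDir : ∀ u ∈ Dir, ∑ x, |u x| ≤ R₁) :
    ∀ p, ∀ u ∈ Dir,
      (∑ b ∈ Bs, |(ContinuousLinearMap.proj (y b) : (S → ℝ) →L[ℝ] ℝ) (Cov p *ᵥ u)|) ≤ C₁ p * R₁ := by
  intro p u hu
  simp only [ContinuousLinearMap.proj_apply]
  exact (sum_abs_site_le Bs hy _).trans ((sum_abs_mulVec_le (Cov p) (hC p) u).trans
    (mul_le_mul_of_nonneg_left (hDir u hu) (hC0 p)))

end L1Letters

end Literature.MathematicalPhysics.QuantumFieldTheory.BalabanImbrieJaffe1984to88.BIJ88WalkProductCutoffVolFree312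

end
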